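import Summits.KontsevichZagierPeriods.KontsevichZagierPeriods.Theses.KinematicFormulas

/-!
# KontsevichZagierPeriods / KinematicFormulas — refutation of `KinematicPlaneConvex` as typed

The crux `KinematicPlaneConvex` (stmt-KontsevichZagierPeriods-5394) quantifies over ALL compact
convex `ℚ`-semialgebraic `K, L ⊂ ℝ²`, including the EMPTY set (which is compact, convex and
semialgebraic). Blaschke's principal kinematic formula `m{g : K ∩ gL ≠ ∅} = 2π(A_K + A_L) + L_K L_L`
is only valid for non-empty bodies: for `L = ∅` the incidence set is empty (measure `0`) while the
right-hand side still contains `2π A_K`. With `K = [0,1]²`, `L = ∅` the four representations of the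
crux have values `0, 2π, 0, 0`, so `[r₀] − [r₁] − [r₂] − [r₃]` has value `−2π ≠ 0` and cannot lie in
`KZ.relations` by soundness of the calculus (`KZ.relations_le_ker_eval_holds`, proved in tree).
Fix for the planner: add the hypotheses `K.Nonempty → L.Nonempty →` (and the same two conjuncts
inside the relator set of `KinematicKernel`).
-/

noncomputable section

open MeasureTheory Set MvPolynomial
open Literature.NumberTheory.Transcendental Literature.ModelTheory.ExponentialFields

namespace Summit.KontsevichZagierPeriods.KinematicFormulas

/-- **Record of the dropped route item `KinematicPlaneConvex`** =
stmt-KontsevichZagierPeriods-5394 (ledger signature verbatim; NOT a route item): the route no longer declares this constant (repair by `restate`/`drop`), while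
the theorem below — which closed the item at 22f638522b28 and is indexed under this name —
still refers to it. Re-declared here under its original fully-qualified name and definiens solely
so that this record keeps elaborating (Theorems files are append-only: the theorem's statement
text may not change). It is FALSE as typed (the empty body qualifies; see below); the route replaced it by KinematicPlaneConvexR. -/
def _root_.Summit.KontsevichZagierPeriods.KontsevichZagierPeriods.Theses.KinematicFormulas.KinematicPlaneConvex : Prop :=
    ∀ K L : Set (Fin 2 → ℝ), Literature.ModelTheory.ExponentialFields.IsSemialgebraic ℚ K →
    Literature.ModelTheory.ExponentialFields.IsSemialgebraic ℚ L → Convex ℝ K → Convex ℝ L →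
    IsCompact K → IsCompact L → ∀ (r₀ r₁ r₂ : Literature.NumberTheory.Transcendental.KZ.IntegralRep
    3) (r₃ : Literature.NumberTheory.Transcendental.KZ.IntegralRep 4), r₀.domain = {x : Fin 3 → ℝ |
    ∃ q ∈ L, (![((1 - x 0 ^ 2) * q 0 - 2 * x 0 * q 1) / (1 + x 0 ^ 2) + x 1, (2 * x 0 * q 0 + (1 - x
    0 ^ 2) * q 1) / (1 + x 0 ^ 2) + x 2] : Fin 2 → ℝ) ∈ K} → Set.EqOn r₀.integrand (fun x => 2 / (1
    + x 0 ^ 2)) r₀.domain → r₁.domain = {x : Fin 3 → ℝ | (![x 1, x 2] : Fin 2 → ℝ) ∈ K} → Set.EqOn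
    r₁.integrand (fun x => 2 / (1 + x 0 ^ 2)) r₁.domain → r₂.domain = {x : Fin 3 → ℝ | (![x 1, x 2]
    : Fin 2 → ℝ) ∈ L} → Set.EqOn r₂.integrand (fun x => 2 / (1 + x 0 ^ 2)) r₂.domain → r₃.domain =
    {z : Fin 4 → ℝ | (0 ≤ z 1 ∧ ∃ q ∈ K, (1 - z 0 ^ 2) * q 0 + 2 * z 0 * q 1 = (1 + z 0 ^ 2) * z 1)
    ∧ (0 ≤ z 3 ∧ ∃ q ∈ L, (1 - z 2 ^ 2) * q 0 + 2 * z 2 * q 1 = (1 + z 2 ^ 2) * z 3)} → Set.EqOn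
    r₃.integrand (fun z => 4 / ((1 + z 0 ^ 2) * (1 + z 2 ^ 2))) r₃.domain →
    Literature.NumberTheory.Transcendental.KZ.of r₀ - Literature.NumberTheory.Transcendental.KZ.of
    r₁ - Literature.NumberTheory.Transcendental.KZ.of r₂ -
    Literature.NumberTheory.Transcendental.KZ.of r₃ ∈
    Literature.NumberTheory.Transcendental.KZ.relations

/-- Refutes `KinematicFormulas.KinematicPlaneConvex`: the crux asserts Blaschke's principal kinematic
relator for ALL compact convex semialgebraic `K, L ⊂ ℝ²`, but the empty set qualifies; with
`K = [0,1]²`, `L = ∅` the incidence, `ℝ × L` and `LineHit K × LineHit L` representations are empty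
(value `0`) while `[ℝ_t × K, 2/(1+t²)]` has value `2π` (Fubini: `∫ 2dt/(1+t²) · ∫_[0,1] 1 · ∫_[0,1] 1`),
so the alleged relation has value `−2π ≠ 0`, contradicting soundness of the KZ calculus
(`KZ.relations_le_ker_eval_holds`). Witness: K = Icc 0 1, L = ∅. Fix: require `K.Nonempty` and
`L.Nonempty`. [folklore] -/
theorem KinematicFormulasKinematicPlaneConvex_refuted :
    ¬ Summit.KontsevichZagierPeriods.KontsevichZagierPeriods.Theses.KinematicFormulas.KinematicPlaneConvex := by
  intro h
  /- (1) empty representations in dimensions 3 and 4 -/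
  have hfun_empty3 : ∀ f : (Fin 3 → ℝ) → ℝ, IsSemialgebraicFunOn ℚ (∅ : Set (Fin 3 → ℝ)) f := by
    intro f
    unfold IsSemialgebraicFunOn
    convert (isSemialgebraic_empty : IsSemialgebraic ℚ (∅ : Set (Fin (3 + 1) → ℝ)))
    ext z
    simp
  have hfun_empty4 : ∀ f : (Fin 4 → ℝ) → ℝ, IsSemialgebraicFunOn ℚ (∅ : Set (Fin 4 → ℝ)) f := by
    intro f
    unfold IsSemialgebraicFunOn
    convert (isSemialgebraic_empty : IsSemialgebraic ℚ (∅ : Set (Fin (4 + 1) → ℝ)))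
    ext z
    simp
  let e3 : KZ.IntegralRep 3 :=
    ⟨∅, fun x => 2 / (1 + x 0 ^ 2), isSemialgebraic_empty, hfun_empty3 _, integrableOn_empty⟩
  let e4 : KZ.IntegralRep 4 :=
    ⟨∅, fun z => 4 / ((1 + z 0 ^ 2) * (1 + z 2 ^ 2)), isSemialgebraic_empty, hfun_empty4 _,
      integrableOn_empty⟩
  have value_e3 : e3.value = 0 := by simp [KZ.IntegralRep.value, e3]
  have value_e4 : e4.value = 0 := by simp [KZ.IntegralRep.value, e4]
  /- (2) the unit square `K = [0,1]²` -/
  have K_eq : (Set.Icc 0 1 : Set (Fin 2 → ℝ)) =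
      {q : Fin 2 → ℝ | (0 ≤ q 0 ∧ 0 ≤ q 1) ∧ (q 0 ≤ 1 ∧ q 1 ≤ 1)} := by
    ext q
    simp [Set.mem_Icc, Pi.le_def, Fin.forall_fin_two]
  have hK_sa : IsSemialgebraic ℚ (Set.Icc 0 1 : Set (Fin 2 → ℝ)) := by
    have h0 := isSemialgebraic_setOf_eval_le (k := ℚ) (R := ℝ) (ι := Fin 2) (C 0) (X 0)
    have h1 := isSemialgebraic_setOf_eval_le (k := ℚ) (R := ℝ) (ι := Fin 2) (C 0) (X 1)
    have h2 := isSemialgebraic_setOf_eval_le (k := ℚ) (R := ℝ) (ι := Fin 2) (X 0) (C 1)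
    have h3 := isSemialgebraic_setOf_eval_le (k := ℚ) (R := ℝ) (ι := Fin 2) (X 1) (C 1)
    have h := (h0.inter h1).inter (h2.inter h3)
    have hEq : (Set.Icc 0 1 : Set (Fin 2 → ℝ)) =
        ({x : Fin 2 → ℝ | aeval x (C 0 : MvPolynomial (Fin 2) ℚ) ≤ aeval x (X 0 : MvPolynomial (Fin 2) ℚ)} ∩
        {x : Fin 2 → ℝ | aeval x (C 0 : MvPolynomial (Fin 2) ℚ) ≤ aeval x (X 1 : MvPolynomial (Fin 2) ℚ)}) ∩
        ({x : Fin 2 → ℝ | aeval x (X 0 : MvPolynomial (Fin 2) ℚ) ≤ aeval x (C 1 : MvPolynomial (Fin 2) ℚ)} ∩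
        {x : Fin 2 → ℝ | aeval x (X 1 : MvPolynomial (Fin 2) ℚ) ≤ aeval x (C 1 : MvPolynomial (Fin 2) ℚ)}) := by
      ext q
      simp [K_eq]
    rw [hEq]
    exact h
  /- (3) the domain `S = ℝ_t × K ⊂ ℝ³` and integrand `f3 = 2/(1+t²)` of `r₁` -/
  have hS_sa : IsSemialgebraic ℚ {x : Fin 3 → ℝ | (0 ≤ x 1 ∧ 0 ≤ x 2) ∧ (x 1 ≤ 1 ∧ x 2 ≤ 1)} := by
    have h0 := isSemialgebraic_setOf_eval_le (k := ℚ) (R := ℝ) (ι := Fin 3) (C 0) (X 1)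
    have h1 := isSemialgebraic_setOf_eval_le (k := ℚ) (R := ℝ) (ι := Fin 3) (C 0) (X 2)
    have h2 := isSemialgebraic_setOf_eval_le (k := ℚ) (R := ℝ) (ι := Fin 3) (X 1) (C 1)
    have h3 := isSemialgebraic_setOf_eval_le (k := ℚ) (R := ℝ) (ι := Fin 3) (X 2) (C 1)
    have h := (h0.inter h1).inter (h2.inter h3)
    have hEq : {x : Fin 3 → ℝ | (0 ≤ x 1 ∧ 0 ≤ x 2) ∧ (x 1 ≤ 1 ∧ x 2 ≤ 1)} =
        ({x : Fin 3 → ℝ | aeval x (C 0 : MvPolynomial (Fin 3) ℚ) ≤ aeval x (X 1 : MvPolynomial (Fin 3) ℚ)} ∩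
        {x : Fin 3 → ℝ | aeval x (C 0 : MvPolynomial (Fin 3) ℚ) ≤ aeval x (X 2 : MvPolynomial (Fin 3) ℚ)}) ∩
        ({x : Fin 3 → ℝ | aeval x (X 1 : MvPolynomial (Fin 3) ℚ) ≤ aeval x (C 1 : MvPolynomial (Fin 3) ℚ)} ∩
        {x : Fin 3 → ℝ | aeval x (X 2 : MvPolynomial (Fin 3) ℚ) ≤ aeval x (C 1 : MvPolynomial (Fin 3) ℚ)}) := by
      ext x
      simp
    rw [hEq]
    exact h
  set S : Set (Fin 3 → ℝ) := {x : Fin 3 → ℝ | (0 ≤ x 1 ∧ 0 ≤ x 2) ∧ (x 1 ≤ 1 ∧ x 2 ≤ 1)} with hS_def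
  have hS_meas : MeasurableSet S := by
    have m1 : Measurable fun x : Fin 3 → ℝ => x 1 := measurable_pi_apply 1
    have m2 : Measurable fun x : Fin 3 → ℝ => x 2 := measurable_pi_apply 2
    exact ((measurableSet_le measurable_const m1).inter (measurableSet_le measurable_const m2)).inter
      ((measurableSet_le m1 measurable_const).inter (measurableSet_le m2 measurable_const))
  set f3 : (Fin 3 → ℝ) → ℝ := fun x => 2 / (1 + x 0 ^ 2) with hf3_def
  -- one-variable factors
  set ind01 : ℝ → ℝ := (Set.Icc (0:ℝ) 1).indicator fun _ => (1:ℝ) with hind_def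
  have integrable_ind01 : Integrable ind01 :=
    (integrableOn_const (C := (1:ℝ)) (s := Set.Icc (0:ℝ) 1) (μ := volume) (by simp)).integrable_indicator
      measurableSet_Icc
  have integral_ind01 : ∫ t, ind01 t = 1 := by
    rw [hind_def, integral_indicator measurableSet_Icc]
    simp
  set g : Fin 3 → ℝ → ℝ := ![fun t => 2 * (1 + t ^ 2)⁻¹, ind01, ind01] with hg_def
  have integrable_g : ∀ i, Integrable (g i) := by
    intro i
    fin_cases i
    · simpa [hg_def] using integrable_inv_one_add_sq.const_mul 2
    · simpa [hg_def] using integrable_ind01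
    · simpa [hg_def] using integrable_ind01
  have indicator_S_f3 : S.indicator f3 = fun x => ∏ i, g i (x i) := by
    funext x
    rw [Fin.prod_univ_three]
    by_cases hx : x ∈ S
    · rw [Set.indicator_of_mem hx]
      have h1 : x 1 ∈ Set.Icc (0:ℝ) 1 := ⟨hx.1.1, hx.2.1⟩
      have h2 : x 2 ∈ Set.Icc (0:ℝ) 1 := ⟨hx.1.2, hx.2.2⟩
      simp [hg_def, hf3_def, hind_def, Set.indicator_of_mem h1, Set.indicator_of_mem h2,
        div_eq_mul_inv]
    · rw [Set.indicator_of_notMem hx]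
      by_cases h1 : x 1 ∈ Set.Icc (0:ℝ) 1
      · have h2 : x 2 ∉ Set.Icc (0:ℝ) 1 := fun h2 => hx ⟨⟨h1.1, h2.1⟩, ⟨h1.2, h2.2⟩⟩
        simp [hg_def, hind_def, Set.indicator_of_notMem h2]
      · simp [hg_def, hind_def, Set.indicator_of_notMem h1]
  have integrable_prod_g : Integrable (fun x : Fin 3 → ℝ => ∏ i, g i (x i)) := by
    have := Integrable.fintype_prod (μ := fun _ : Fin 3 => (volume : Measure ℝ)) integrable_g
    simpa [MeasureTheory.volume_pi] using this
  have integrableOn_f3_S : IntegrableOn f3 S := by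
    rw [← integrable_indicator_iff hS_meas, indicator_S_f3]
    exact integrable_prod_g
  have hsfun : IsSemialgebraicFunOn ℚ S f3 := by
    have hq : ∀ x ∈ S, aeval x (1 + X 0 ^ 2 : MvPolynomial (Fin 3) ℚ) ≠ 0 := fun x _ => by
      simp; positivity
    refine (isSemialgebraicFunOn_aeval_div_aeval (k := ℚ) (R := ℝ) hS_sa (C 2) (1 + X 0 ^ 2) hq).congr
      fun x _ => ?_
    simp [hf3_def]
  let r₁ : KZ.IntegralRep 3 := ⟨S, f3, hS_sa, hsfun, integrableOn_f3_S⟩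
  have integral_g0 : ∫ t, g 0 t = 2 * Real.pi := by
    simp only [hg_def, Matrix.cons_val_zero]
    rw [integral_const_mul, integral_univ_inv_one_add_sq]
  have integral_g1 : ∫ t, g 1 t = 1 := by
    have : g 1 = ind01 := by simp [hg_def]
    rw [this, integral_ind01]
  have integral_g2 : ∫ t, g 2 t = 1 := by
    have : g 2 = ind01 := by simp [hg_def]
    rw [this, integral_ind01]
  have value_r₁ : r₁.value = 2 * Real.pi := by
    change ∫ x in S, f3 x = _
    rw [← integral_indicator hS_meas, indicator_S_f3, integral_fintype_prod_volume_eq_prod,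
      Fin.prod_univ_three, integral_g0, integral_g1, integral_g2]
    ring
  /- (4) instantiate the crux at `K = [0,1]²`, `L = ∅` and contradict soundness -/
  have hmem := h (Set.Icc 0 1) ∅ hK_sa isSemialgebraic_empty (convex_Icc 0 1) convex_empty
    isCompact_Icc isCompact_empty e3 r₁ e3 e4
    (by ext x; simp [e3]) (fun _ _ => rfl)
    (by ext x; simp [r₁, hS_def, Set.mem_Icc, Pi.le_def, Fin.forall_fin_two])
    (fun _ _ => rfl)
    (by ext x; simp [e3]) (fun _ _ => rfl)
    (by ext z; simp [e4]) (fun _ _ => rfl)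
  have h0 := KZ.relations_le_ker_eval_holds hmem
  rw [AddMonoidHom.mem_ker] at h0
  simp only [map_sub, KZ.eval_of, value_e3, value_e4, value_r₁] at h0
  have hne : (0:ℝ) - 2 * Real.pi - 0 - 0 ≠ 0 := by
    have := Real.pi_pos
    linarith
  exact hne h0

end Summit.KontsevichZagierPeriods.KinematicFormulas

end
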